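import Summits.QuantumFields.YangMills.Theorems.LuscherReductionTwistedTraceScalingTrackStub
import Summits.QuantumFields.YangMills.Theorems.LuscherReductionTwistedTraceScalingTowerOfUniform
import Summits.QuantumFields.YangMills.Theorems.TwistedTraceScaling.Negative.FixedLatticeTraceLawFalseWithoutThreshold
import HarnessLib

/-!
# NON-VACUITY of the XL stub CMP-2LOOP of line «twolattice» skeleton rev 3 (crux `TwistedTraceScaling`, stmt-QuantumFields-20203): its chain of CALIBRATED
# antecedents is inhabited at every depth — a corollary of the landed TRACK stub (kernel answer to the line card's cheapest falsifier (i))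

Route `LuscherReduction` (owner ym-beyond-p1), LEAD ym-lead-20203-twolattice g1.  Skeleton r3 (owner g29, sha16 1a2ae9b1ae61a9c5) registers
`stub_cmpTwoLoop : Stmt.stub_cmpTwoLoop` (XL), whose conclusion is guarded by the calibrated hypotheses `1/(4lam³) ≤ x̂`, `|x̂ − 2β₁| ≤ δ·2β₁`,
`|T·calLambda/L − s| ≤ δ` (`x̂ = flowInvSq φ β (k+1)`), and the card (`Lines-twolattice-r3.md`) lists as cheapest falsifier (i) «anti-vacuity of CMP-2LOOP's
calibrated hypotheses — exhibit numerically … a β₁ and T meeting them».  No numerics are needed: the TRACK stub (`stub_labelTracking`, p548356) says that label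
matching DELIVERS the three hypotheses deep enough in the window, and the window is inhabited (`Negative.exists_inFemtoWindow`), every `L ≥ M²` has an E1 landing,
and matched couplings exist (`Tower.exists_matched`).  THIS FILE proves

* ★ `Track.cmpTwoLoop_antecedents_inhabited` — for every `M ≥ 2`, `δ > 0`, `s > 0`, two-loop family `φ` and EVERY depth bound `lam0 > 0` there are
  `0 < lam ≤ lam0`, `L = M²`, `β` in the window, an E1 base `(b, k)`, `β₁ ≥ 1` and `T` satisfying ALL antecedents of CMP-2LOOP's conclusion.  Hence the
  registered XL stub is not vacuously true at any `lam0` a prover might choose (probe class P2 for the calibrated texts).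

HONEST FRAMING: a non-vacuity certificate (bookkeeping) on the conditional femto rung R2b1; CMP-2LOOP itself is OPEN (XL, not in print); nothing here bears on
infinite volume, a mass gap, or Clay.  No definitions, no new named facts.  Cone-free imports.
-/

set_option autoImplicit false

noncomputable section

open Real

namespace Summit.QuantumFields.YangMills.Theorems.FemtoTransferGap.TwoLattice

open Summit.QuantumFields.YangMills.Theorems.FemtoTransferGap
open Summit.QuantumFields.YangMills.Theorems.FemtoTransferGap.TraceDoor
open Literature.MathematicalPhysics.QuantumFieldTheory.Balaban1983to89

namespace Track

/-- E1 landing (private copy of `Tower.exists_tower_landing`, `…TowerE1` §1 — kept private to stay out of the route file's import cone): for `M ≥ 2`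
and `L ≥ M²` there are `k` and a base `b ∈ [M, M²)` with `b·M^{k+1} ≤ L < b·M^k·(M+1)`. [folklore] -/
private theorem landing {M : ℕ} (hM : 2 ≤ M) {L : ℕ} (hL : M ^ 2 ≤ L) :
    ∃ k b : ℕ, M ≤ b ∧ b < M ^ 2 ∧ b * M ^ (k + 1) ≤ L ∧ L < b * M ^ k * (M + 1) := by
  -- proof copied from `Tower.exists_tower_landing` (ported there from the owner's CoverageSketch.lean)
  have hM1 : 1 < M := hM
  have hL0 : L ≠ 0 := by
    have : 0 < M ^ 2 := by positivity
    omega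
  have h1 : M ^ Nat.log M L ≤ L := Nat.pow_log_le_self M hL0
  have h2 : L < M ^ (Nat.log M L + 1) := Nat.lt_pow_succ_log_self hM1 L
  have he2 : 2 ≤ Nat.log M L := Nat.le_log_of_pow_le hM1 hL
  obtain ⟨k, hk⟩ : ∃ k, Nat.log M L = k + 2 := ⟨Nat.log M L - 2, by omega⟩
  rw [hk] at h1 h2
  have hpow : 0 < M ^ (k + 1) := by positivity
  have hL1 : M ≤ L / M ^ (k + 1) := by
    apply (Nat.le_div_iff_mul_le hpow).mpr
    calc M * M ^ (k + 1) = M ^ (k + 2) := by ring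
      _ ≤ L := h1
  refine ⟨k, L / M ^ (k + 1), hL1, ?_, Nat.div_mul_le_self L (M ^ (k + 1)), ?_⟩
  · apply (Nat.div_lt_iff_lt_mul hpow).mpr
    calc L < M ^ (k + 2 + 1) := h2
      _ = M ^ 2 * M ^ (k + 1) := by ring
  · have hstep : M ^ (k + 1) ≤ L / M ^ (k + 1) * M ^ k := by
      calc M ^ (k + 1) = M * M ^ k := by ring
        _ ≤ L / M ^ (k + 1) * M ^ k := Nat.mul_le_mul_right _ hL1
    calc L < L / M ^ (k + 1) * M ^ (k + 1) + M ^ (k + 1) := Nat.lt_div_mul_add hpow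
      _ ≤ L / M ^ (k + 1) * M ^ (k + 1) + L / M ^ (k + 1) * M ^ k := by omega
      _ = L / M ^ (k + 1) * M ^ k * (M + 1) := by ring

/-- ★ **CMP-2LOOP is not vacuous**: at every depth bound `lam0` the chain of calibrated antecedents of the registered XL stub `Stmt.stub_cmpTwoLoop` is
inhabited — witnesses `lam = min(lam0, lam1(TRACK), 1/2)`, `L = M²`, `β` with `Λ(β, L) = lam` (`Negative.exists_inFemtoWindow`), the E1 landing `(b, k)` of
`L`, the matched `β₁ ≥ 1` on `b` (`Tower.exists_matched`), `T = femtoSteps s β L`; the three calibrated hypotheses are then the landed TRACK stub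
`stub_labelTracking`. [cite: LuscherWeiszWolff1991, §2] [cite: Balaban1987RG1, (0.20) p.256] -/
theorem cmpTwoLoop_antecedents_inhabited {M : ℕ} (hM : 2 ≤ M) {δ : ℝ} (hδ : 0 < δ) {s : ℝ} (hs : 0 < s)
    (φ : FlowStep.HBeta) (hφ : Stmt.twoLoopLawH (B12Normalization.stepBal 2 M) (twoLoopStepBal M) φ) {lam0 : ℝ} (hlam0 : 0 < lam0) :
    ∃ lam : ℝ, 0 < lam ∧ lam ≤ lam0 ∧ ∃ (L : ℕ) (_ : NeZero L), M ^ 2 ≤ L ∧ ∃ β : ℝ, InFemtoWindow lam β L ∧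
      ∃ (b k : ℕ) (_ : NeZero b), M ≤ b ∧ b < M ^ 2 ∧ b * M ^ (k + 1) ≤ L ∧ L < b * M ^ k * (M + 1) ∧
        1 / (4 * lam ^ 3) ≤ flowInvSq φ β (k + 1) ∧
        ∃ β₁ : ℝ, 1 ≤ β₁ ∧ |flowInvSq φ β (k + 1) - 2 * β₁| ≤ δ * (2 * β₁) ∧
          ∃ T : ℕ, |(T : ℝ) * calLambda φ β (k + 1) b / L - s| ≤ δ := by
  obtain ⟨lam1, hlam1, htrack⟩ := stub_labelTracking M hM δ hδ s hs φ hφ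
  set lam : ℝ := min lam0 (min lam1 (1 / 2)) with hlam_def
  have hlam : 0 < lam := lt_min hlam0 (lt_min hlam1 (by norm_num))
  have hle0 : lam ≤ lam0 := min_le_left _ _
  have hle1 : lam ≤ lam1 := (min_le_right _ _).trans (min_le_left _ _)
  have hlehalf : lam ≤ 1 / 2 := (min_le_right _ _).trans (min_le_right _ _)
  haveI hL : NeZero (M ^ 2) := ⟨by positivity⟩
  obtain ⟨β, hW, _⟩ := Summit.QuantumFields.YangMills.Theorems.TwistedTraceScaling.Negative.exists_inFemtoWindow (M ^ 2) hlam (by linarith)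
  obtain ⟨k, b, hMb, hbM, hbL, hLb⟩ := landing hM (le_refl (M ^ 2))
  haveI hb : NeZero b := ⟨by omega⟩
  obtain ⟨β₁, hβ₁, hmatch⟩ :=
    Tower.exists_matched b (v := invRunningCoupling β (M ^ 2)) (Tower.one_le_invRunningCoupling_of_window hlam hlehalf hW)
  obtain ⟨h1, h2, h3⟩ := htrack lam hlam hle1 (M ^ 2) le_rfl β hW b k hMb hbM hbL hLb β₁ hβ₁ hmatch
  exact ⟨lam, hlam, hle0, M ^ 2, hL, le_rfl, β, hW, b, k, hb, hMb, hbM, hbL, hLb, h1, β₁, hβ₁, h2, femtoSteps s β (M ^ 2), h3⟩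

end Track

end Summit.QuantumFields.YangMills.Theorems.FemtoTransferGap.TwoLattice

end
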